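import Summits.QuantumFields.BalabanUV.T4Continuum.Support.SmallCouplingEntryDecay

/-!
# T⁴ programme, NE2 (U1a) sub-row Δ3 — `hdec` AT SMALL COUPLING, RELATIVE FORM: the hypothesis on the perturbation is the
# WEIGHTED ANALOGUE OF TIER B's (H-bd), `Σ_j e^{δ′ρ}‖(P_k·(𝒢^{(k)}⊗1))(i,j)‖ ≤ κ_w`, not a bound on `P_k` itself

NE2 formalisation swarm `b2b-balaban-t4-ne2-formalise-*`, leaf prover 05 (gen 5); file C of the supplier item «NE2-Δ3-SMALL-COUPLING»
(INTENT CLAIMS.log 2026-08-20).  The relative resolvent bound of `Support/WeightedRowSumResolvent` v1.1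
(`wrow_inv_add_smul_le_of_rel`: `X = 𝒢 − t·X·(P·𝒢)` row by row) run on the NE2 tower: **`wrow_pert_inv_le_of_rel`**,
**`hdec_pertCovC_small_rel (hPG : ∀ k i, Σ_j e^{δ′ρ}‖(P_k·(𝒢^{(k)}⊗1))(i,j)‖ ≤ κ_w) (ht : ‖t‖·κ_w < 1) (k) :
EntryDecay dist₀ (pertCovC L M 1 _ P t k) (W_G/(1 − ‖t‖κ_w)) δ′`** (the owner's `BlockSumDecay.hdec_pertCovC_of_blockL1` BY NAME on
file B's `blockL1Decay_of_wrow`).  WHY: tier B's perturbation laws bound `‖P·𝒢‖`, not `‖P‖` (the first-order pieces are unbounded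
alone); this is the SAME shape in the weighted row-sum currency, so that a future weighted row-sum bound for `∇𝒢^{(k)}`, `𝒢^{(k)}∇*`
(pv15's open node: the second and third entries of (1.110)) would feed `hdec` for first-order perturbations through THIS theorem
with no further resolvent work.  Nothing of that input is claimed here.

HONEST FRAMING (T4-DAG p. 1).  MODEL level; `a = 1`, dimension `d + 1`; the relative bound `hPG` is DISPLAYED (dischargeable today
only for perturbations bounded in the weighted norm, via file B); sub-row Δ3 NOT closed for Bałaban's carrier; nothing of NE3;
**NE2 (U1a) NOT PROVED**; spine PROVED 0/9; NOT infinite volume, NOT a mass gap, NOT Clay.  HONEST DEPENDENCY: continuum YM on T⁴ ⇐ BetaPertH ∧ nine spine estimates (0/9 proved); BetaPertH ⇐ (D1) ∧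
(D4) ∧ CAP+tail; G-an2-4 gates asym, D1 and NE2/3/4.  No definition; no `sorry`.
-/

noncomputable section

open scoped BigOperators ComplexConjugate Matrix Kronecker
open Finset

namespace Summit.QuantumFields.BalabanUV.T4Continuum.SmallCouplingEntryDecayRel

open Literature.MathematicalPhysics.QuantumFieldTheory.Balaban1983to89.B5Prop11Plancherel (Cst Tor fine)
open Literature.MathematicalPhysics.QuantumFieldTheory.Balaban1983to89.B5G183RateUnitTower (lev)
open Literature.MathematicalPhysics.QuantumFieldTheory.Balaban1983to89.B4TorusKernel (periodConst)
open Literature.MathematicalPhysics.QuantumFieldTheory.Balaban1983to89.B4TorusKernel.MultiPeriod (torusSupNorm)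
open Literature.MathematicalPhysics.QuantumFieldTheory.Balaban1983to89.B4Sect5Proof (latticeConst)
open Literature.MathematicalPhysics.QuantumFieldTheory.Balaban1983to89.B5Blocks16 (blockOf)
open Literature.MathematicalPhysics.QuantumFieldTheory.Balaban1983to89.B5G183Strip (kappa183)
open Literature.MathematicalPhysics.QuantumFieldTheory.Balaban1983to89.B5G183CovDecay (MD183)
open Literature.MathematicalPhysics.QuantumFieldTheory.Balaban1983to89.B6LowerBound2153Torus (rep)
open Summit.QuantumFields.BalabanUV.T4Continuum
open Summit.QuantumFields.BalabanUV.T4Continuum.BalabanAveragedTowerUnit (idx calGlev)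
open Summit.QuantumFields.BalabanUV.T4Continuum.KingPairingPlantedLaw (calDalev calDalev_inv isUnit_det_calDalev)
open Summit.QuantumFields.BalabanUV.T4Continuum.KroneckerLift (kron_inv isUnit_det_kron)
open Summit.QuantumFields.BalabanUV.T4Continuum.NE2ColourPerturbedLayer (pertCovC)
open Summit.QuantumFields.BalabanUV.T4Continuum.DecayRateInterpolation (EntryDecay)
open Summit.QuantumFields.BalabanUV.T4Continuum.BlockSumDecay (prtQK BlockL1Decay hdec_pertCovC_of_blockL1)
open Summit.QuantumFields.BalabanUV.T4Continuum.WeightedRowSumResolvent (wrow_inv_add_smul_le_of_rel)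
open Summit.QuantumFields.BalabanUV.T4Continuum.SmallCouplingEntryDecay (torusSupNorm_rep_triangle torusSupNorm_rep_nonneg
  wrow_calGlev_kron_le blockL1Decay_of_wrow)

variable {d : ℕ} (L : ℕ) [NeZero L] (M : Fin (d + 1) → ℕ) [hM : ∀ μ, NeZero (M μ)]
variable {o : Type*} [Fintype o] [DecidableEq o]

/-- **WEIGHTED ROW SUMS OF THE PERTURBED FINE PROPAGATORS FROM THE RELATIVE BOUND** (`a = 1`, dimension `d + 1`):
`Σ_j e^{δ′ρ}‖(P_k·(𝒢^{(k)}⊗1))(i,j)‖ ≤ κ_w` at every level and `‖t‖κ_w < 1` ⟹ `(Δ_1^{(k)}⊗1 + tP_k)⁻¹` exists with weighted row sums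
`≤ W_G/(1 − ‖t‖κ_w)`. [folklore] -/
theorem wrow_pert_inv_le_of_rel {δ' : ℝ} (hδ0 : 0 ≤ δ') (h₁ : δ' < 1 / (2 * ((d : ℝ) + 1))) (h₂ : δ' < kappa183 (d + 1) / (d + 1))
    {P : (k : ℕ) → Matrix (idx L M k × o) (idx L M k × o) ℂ} {κw : ℝ}
    (hPG : ∀ k (i : idx L M k × o), ∑ j, Real.exp (δ' * torusSupNorm M
        (rep M (blockOf (lev L k) M i.1.1) - rep M (blockOf (lev L k) M j.1.1)))
        * ‖(P k * (calGlev L M 1 one_pos k ⊗ₖ (1 : Matrix o o ℂ))) i j‖ ≤ κw)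
    {t : ℂ} (ht : ‖t‖ * κw < 1) (k : ℕ) (i : idx L M k × o) :
    IsUnit (calDalev L M 1 one_pos k ⊗ₖ (1 : Matrix o o ℂ) + t • P k).det ∧
      ∑ j, Real.exp (δ' * torusSupNorm M
        (rep M (blockOf (lev L k) M i.1.1) - rep M (blockOf (lev L k) M j.1.1)))
          * ‖(calDalev L M 1 one_pos k ⊗ₖ (1 : Matrix o o ℂ) + t • P k)⁻¹ i j‖
        ≤ (2 * d * 2 ^ d * Real.exp (1 / (2 * (d + 1))) * latticeConst (d + 1) (1 / (2 * (d + 1)) - δ')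
            + (d + 1) * (MD183 (d + 1) d * periodConst (kappa183 (d + 1)) d * latticeConst (d + 1) (kappa183 (d + 1) / (d + 1) - δ')))
          / (1 - ‖t‖ * κw) := by
  have hD : IsUnit (calDalev L M 1 one_pos k ⊗ₖ (1 : Matrix o o ℂ)).det := isUnit_det_kron o (isUnit_det_calDalev L M 1 one_pos k)
  have hinv : (calDalev L M 1 one_pos k ⊗ₖ (1 : Matrix o o ℂ))⁻¹ = calGlev L M 1 one_pos k ⊗ₖ (1 : Matrix o o ℂ) := by
    rw [kron_inv, calDalev_inv]
  refine wrow_inv_add_smul_le_of_rel (ρ := fun i j : idx L M k × o =>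
      torusSupNorm M (rep M (blockOf (lev L k) M i.1.1) - rep M (blockOf (lev L k) M j.1.1)))
    (fun i j m => torusSupNorm_rep_triangle M _ _ _) (fun i j => torusSupNorm_rep_nonneg M _ _) hδ0 hD
    (fun i => ?_) (fun i => ?_) ht i
  · rw [hinv]; exact wrow_calGlev_kron_le L M h₁ h₂ k i
  · rw [hinv]; exact hPG k i

/-- **`hdec` AT SMALL COUPLING, RELATIVE FORM**: the weighted (H-bd)-analogue `hPG` and `‖t‖κ_w < 1` ⟹
`∀ k, EntryDecay dist₀ (pertCovC L M 1 _ P t k) (W_G/(1 − ‖t‖κ_w)) δ′` — the owner's `hdec_pertCovC_of_blockL1` BY NAME on file B's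
`blockL1Decay_of_wrow`.  MODEL level; `hPG` displayed; Δ3 NOT closed; NE2 NOT proved. [folklore] -/
theorem hdec_pertCovC_small_rel {δ' : ℝ} (hδ0 : 0 ≤ δ') (h₁ : δ' < 1 / (2 * ((d : ℝ) + 1))) (h₂ : δ' < kappa183 (d + 1) / (d + 1))
    {P : (k : ℕ) → Matrix (idx L M k × o) (idx L M k × o) ℂ} {κw : ℝ}
    (hPG : ∀ k (i : idx L M k × o), ∑ j, Real.exp (δ' * torusSupNorm M
        (rep M (blockOf (lev L k) M i.1.1) - rep M (blockOf (lev L k) M j.1.1)))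
        * ‖(P k * (calGlev L M 1 one_pos k ⊗ₖ (1 : Matrix o o ℂ))) i j‖ ≤ κw)
    {t : ℂ} (ht : ‖t‖ * κw < 1) (k : ℕ) :
    EntryDecay (fun x y : idx L M 0 × o => torusSupNorm M (fun ν => (((x.1.1 ν).val : ℕ) : ℤ) - (((y.1.1 ν).val : ℕ) : ℤ)))
      (pertCovC L M 1 one_pos P t k)
      ((2 * d * 2 ^ d * Real.exp (1 / (2 * (d + 1))) * latticeConst (d + 1) (1 / (2 * (d + 1)) - δ')
            + (d + 1) * (MD183 (d + 1) d * periodConst (kappa183 (d + 1)) d * latticeConst (d + 1) (kappa183 (d + 1) / (d + 1) - δ')))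
          / (1 - ‖t‖ * κw)) δ' :=
  hdec_pertCovC_of_blockL1 L M o 1 one_pos
    (blockL1Decay_of_wrow L M (fun k i => (wrow_pert_inv_le_of_rel L M hδ0 h₁ h₂ hPG ht k i).2)) k

end Summit.QuantumFields.BalabanUV.T4Continuum.SmallCouplingEntryDecayRel

end
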